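import Mathlib
import HarnessLib

/-!
# PneNP / ExpanderLinearGenerators — free generators in `SL₂(ℤ)` (Sanov's ping-pong) and the
absence of short relations in `SL₂(ℤ/N)` (stmt-PneNP-11443, non-vacuity construction, file 1)

Route `PneNP/ExpanderLinearGenerators`, support item stmt-PneNP-11443
(`LinearGeneratorDepthFregeHard`, Krajíček's Problem 19.4.5 in universal-expander form). The
item quantifies over `ℓ`-sparse unsolvable systems over `𝔽₂` on `n` variables whose row supports
form an `(n^(1-δ), 3ℓ/4)`-boundary expander; the localities `ℓ ≤ 8` admit NO such system
(`…LocalityFloor`, `…LocalityEight`). This file starts the proof that from `ℓ = 16` on such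
systems DO exist for every large `n`: the Tseitin systems of the Cayley graphs of `SL₂(ℤ/N)`
with respect to the eight free generators `s_k = BᵏAB⁻ᵏ` (`k < 8`), `A = [[1,2],[0,1]]`,
`B = [[1,0],[2,1]]` — Margulis's 1982 graphs without short cycles.

* `Letter` (generator index `k < 8` and sign), `Letter.bar`, `IsReduced`, `invWord`;
* `Letter.mat = BᵏA^{±1}B⁻ᵏ = [[1-4ke, 2e],[-8k²e, 1+4ke]]`, `wordMat`; **`wordMat_ne_one`** — a
  nonempty reduced word is not the identity (Sanov 1947: ping-pong of `A`- and `B`-moves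
  between `{|x| > |y|}` and `{|x| < |y|}` in `ℤ²`); `abs_wordMat_le` — entries `≤ 800^L`;
* `gen N σ ∈ SL₂(ℤ/N)`, `wordVal`, **`wordVal_ne_one`** — if `2 · 800^L < N`, no nonempty
  reduced word of length `≤ L` is a relation in `SL₂(ℤ/N)`.

References: G. A. Margulis, *Explicit constructions of graphs without short cycles and low
density codes*, Combinatorica 2 (1982) 71–78 [Margulis1982]; R. C. Lyndon, P. E. Schupp,
*Combinatorial Group Theory*, Springer 1977, §III.12 (the ping-pong lemma).
-/

namespace Summit.PneNP.PneNP.Theorems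

set_option linter.dupNamespace false -- `Summit.PneNP.PneNP.…`: summit = sub-problem (D-0017)

namespace FreeCayley

/-- A letter: a generator index `k < 8` and a sign (`true` = `s_k`, else `s_k⁻¹`). [folklore] -/
abbrev Letter : Type := Fin 8 × Bool

/-- The formal inverse of a letter. [folklore] -/
def Letter.bar (σ : Letter) : Letter := (σ.1, !σ.2)

/-- `bar` is an involution. [folklore] -/
@[simp] theorem Letter.bar_bar (σ : Letter) : σ.bar.bar = σ := by simp [Letter.bar]

/-- The index of the formal inverse. [folklore] -/
@[simp] theorem Letter.bar_fst (σ : Letter) : σ.bar.1 = σ.1 := rfl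

/-- The sign of the formal inverse. [folklore] -/
@[simp] theorem Letter.bar_snd (σ : Letter) : σ.bar.2 = !σ.2 := rfl

/-- `bar` is injective. [folklore] -/
theorem Letter.bar_inj {σ τ : Letter} : σ.bar = τ.bar ↔ σ = τ :=
  ⟨fun h => by simpa using congrArg Letter.bar h, fun h => h ▸ rfl⟩

/-- The sign of a letter as an integer `±1`. [folklore] -/
def Letter.sgn (σ : Letter) : ℤ := if σ.2 then 1 else -1

/-- The sign of the formal inverse is the opposite sign. [folklore] -/
@[simp] theorem Letter.sgn_bar (σ : Letter) : σ.bar.sgn = -σ.sgn := by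
  obtain ⟨k, b⟩ := σ
  cases b <;> simp [Letter.sgn, Letter.bar]

/-- A word (head = leftmost factor) is REDUCED: no letter next to its formal inverse. [folklore] -/
@[folklore] def IsReduced (w : List Letter) : Prop := w.IsChain fun a b => b ≠ a.bar

/-- The empty word is reduced. [folklore] -/
theorem isReduced_nil : IsReduced [] := List.IsChain.nil

/-- One-letter words are reduced. [folklore] -/
theorem isReduced_singleton (σ : Letter) : IsReduced [σ] := List.isChain_singleton σ

/-- Unfolding `IsReduced` on two leading letters. [folklore] -/
theorem isReduced_cons_cons {σ τ : Letter} {w : List Letter} :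
    IsReduced (σ :: τ :: w) ↔ τ ≠ σ.bar ∧ IsReduced (τ :: w) := List.isChain_cons_cons

/-- A reduced word stays reduced after dropping its head. [folklore] -/
theorem IsReduced.tail {σ : Letter} {w : List Letter} (h : IsReduced (σ :: w)) : IsReduced w := by
  cases w with
  | nil => exact isReduced_nil
  | cons τ w => exact (isReduced_cons_cons.1 h).2

/-- Prepending a non-cancelling letter keeps a word reduced. [folklore] -/
theorem IsReduced.cons {σ : Letter} {w : List Letter} (h : IsReduced w)
    (hσ : ∀ τ ∈ w.head?, τ ≠ σ.bar) : IsReduced (σ :: w) := by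
  cases w with
  | nil => exact isReduced_singleton σ
  | cons τ w => exact isReduced_cons_cons.2 ⟨hσ τ rfl, h⟩

/-- The formal inverse of a word: reverse and invert every letter. [folklore] -/
def invWord (w : List Letter) : List Letter := (w.map Letter.bar).reverse

/-- Length of the formal inverse. [folklore] -/
@[simp] theorem length_invWord (w : List Letter) : (invWord w).length = w.length := by
  simp [invWord]

/-- The formal inverse of a cons. [folklore] -/
theorem invWord_cons (σ : Letter) (w : List Letter) : invWord (σ :: w) = invWord w ++ [σ.bar] := by
  simp [invWord]

/-- The formal inverse of a reduced word is reduced. [folklore] -/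
theorem IsReduced.invWord {w : List Letter} (h : IsReduced w) :
    IsReduced (FreeCayley.invWord w) := by
  unfold IsReduced FreeCayley.invWord
  rw [List.isChain_reverse, List.isChain_map]
  refine List.IsChain.imp (fun a b hab => ?_) h
  intro hEq
  exact hab (by rw [hEq, Letter.bar_bar])

/-- The last letter of the formal inverse of `σ :: w` is `σ.bar`. [folklore] -/
theorem getLast?_invWord_cons (σ : Letter) (w : List Letter) :
    (invWord (σ :: w)).getLast? = some σ.bar := by
  rw [invWord_cons, List.getLast?_append, List.getLast?_singleton]; rfl

/-- **Gluing a relation.** If `σ :: w` and `σ' :: w'` are reduced with `σ ≠ σ'`, then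
`invWord (σ' :: w') ++ (σ :: w)` is reduced. [folklore] -/
theorem isReduced_invWord_append {σ σ' : Letter} {w w' : List Letter} (h : IsReduced (σ :: w))
    (h' : IsReduced (σ' :: w')) (hne : σ ≠ σ') : IsReduced (invWord (σ' :: w') ++ (σ :: w)) := by
  unfold IsReduced
  rw [List.isChain_append]
  refine ⟨h'.invWord, h, ?_⟩
  intro x hx y hy
  rw [getLast?_invWord_cons] at hx
  simp only [Option.mem_def, Option.some.injEq, List.head?_cons] at hx hy
  subst hx; subst hy
  simpa using hne

/-! ### The integer matrices `BᵏA^{±1}B⁻ᵏ` and their action on `ℤ²` -/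

/-- The integer matrix of a letter: `BᵏAᵉB⁻ᵏ = [[1 - 4ke, 2e], [-8k²e, 1 + 4ke]]`
(`A = [[1,2],[0,1]]`, `B = [[1,0],[2,1]]`, `e = ±1`). [cite: Margulis1982, main construction] -/
def Letter.mat (σ : Letter) : Matrix (Fin 2) (Fin 2) ℤ :=
  !![1 - 4 * (σ.1 : ℤ) * σ.sgn, 2 * σ.sgn; -8 * (σ.1 : ℤ) ^ 2 * σ.sgn, 1 + 4 * (σ.1 : ℤ) * σ.sgn]

/-- The matrix of a word (head = leftmost factor). [folklore] -/
def wordMat : List Letter → Matrix (Fin 2) (Fin 2) ℤ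
  | [] => 1
  | σ :: w => σ.mat * wordMat w

/-- The matrix of a letter has determinant one. [folklore] -/
theorem Letter.det_mat (σ : Letter) : σ.mat.det = 1 := by
  rw [Matrix.det_fin_two]
  simp [Letter.mat]
  ring

/-- A letter and its formal inverse have inverse matrices. [folklore] -/
theorem Letter.mat_mul_mat_bar (σ : Letter) : σ.mat * σ.bar.mat = 1 := by
  ext i j
  fin_cases i <;> fin_cases j <;>
    simp [Letter.mat, Matrix.mul_apply, Fin.sum_univ_two] <;> ring

/-- The `A`-move `(x, y) ↦ (x + 2ay, y)` on `ℤ²` (the action of `Aᵃ`). [folklore] -/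
def tA (a : ℤ) (v : ℤ × ℤ) : ℤ × ℤ := (v.1 + 2 * a * v.2, v.2)

/-- The `B`-move `(x, y) ↦ (x, 2bx + y)` on `ℤ²` (the action of `Bᵇ`). [folklore] -/
def tB (b : ℤ) (v : ℤ × ℤ) : ℤ × ℤ := (v.1, 2 * b * v.1 + v.2)

/-- The action of a letter on `ℤ²`: `BᵏAᵉB⁻ᵏ`. [folklore] -/
def Letter.act (σ : Letter) (v : ℤ × ℤ) : ℤ × ℤ := tB σ.1 (tA σ.sgn (tB (-(σ.1 : ℤ)) v))

/-- The action of a word on `ℤ²` (head acts last, i.e. outermost). [folklore] -/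
def wordAct : List Letter → ℤ × ℤ → ℤ × ℤ
  | [] => id
  | σ :: w => fun v => σ.act (wordAct w v)

/-- `B`-moves compose additively. [folklore] -/
theorem tB_tB (b c : ℤ) (v : ℤ × ℤ) : tB b (tB c v) = tB (b + c) v := by
  unfold tB; ext <;> simp; ring

/-- `A`-moves compose additively. [folklore] -/
theorem tA_tA (a c : ℤ) (v : ℤ × ℤ) : tA a (tA c v) = tA (a + c) v := by
  unfold tA; ext <;> simp; ring

/-- The trivial `B`-move. [folklore] -/
@[simp] theorem tB_zero (v : ℤ × ℤ) : tB 0 v = v := by unfold tB; ext <;> simp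

/-- `B`-moves fix the vector `(0, 1)`. [folklore] -/
@[simp] theorem tB_base (b : ℤ) : tB b (0, 1) = (0, 1) := by simp [tB]

/-- **Ping.** A nontrivial `B`-move sends `{|x| > |y|}` into `{|x| < |y|}`. [folklore] -/
theorem ping {b : ℤ} (hb : b ≠ 0) {v : ℤ × ℤ} (hv : |v.2| < |v.1|) :
    |(tB b v).1| < |(tB b v).2| := by
  simp only [tB]
  have h1 : (1 : ℤ) ≤ |b| := Int.one_le_abs hb
  have h2 : |2 * b * v.1| = 2 * |b| * |v.1| := by
    rw [abs_mul, abs_mul]; simp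
  have h3 : |2 * b * v.1| ≤ |2 * b * v.1 + v.2| + |v.2| := by
    have := abs_sub (2 * b * v.1 + v.2) v.2
    simpa using this
  have h4 : 2 * |v.1| ≤ 2 * |b| * |v.1| := by
    have := abs_nonneg v.1
    nlinarith
  linarith

/-- **Pong.** A nontrivial `A`-move sends `{|x| < |y|}` into `{|x| > |y|}`. [folklore] -/
theorem pong {a : ℤ} (ha : a ≠ 0) {v : ℤ × ℤ} (hv : |v.1| < |v.2|) :
    |(tA a v).2| < |(tA a v).1| := by
  simp only [tA]
  have h1 : (1 : ℤ) ≤ |a| := Int.one_le_abs ha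
  have h2 : |2 * a * v.2| = 2 * |a| * |v.2| := by
    rw [abs_mul, abs_mul]; simp
  have h3 : |2 * a * v.2| ≤ |v.1 + 2 * a * v.2| + |v.1| := by
    have := abs_sub (v.1 + 2 * a * v.2) v.1
    simpa using this
  have h4 : 2 * |v.2| ≤ 2 * |a| * |v.2| := by
    have := abs_nonneg v.2
    nlinarith
  linarith

/-- **Sanov's ping-pong invariant.** For a reduced word with head `σ = (k, ε)`, the image of
`(0, 1)` is `Bᵏ Aᵃ u` for some `a ≠ 0` of the sign of `ε` and some `u` with `|u₁| < |u₂|`.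
[folklore] -/
theorem wordAct_invariant : ∀ (w : List Letter) (σ : Letter), IsReduced (σ :: w) →
    ∃ (a : ℤ) (u : ℤ × ℤ), a ≠ 0 ∧ (0 < a ↔ σ.2 = true) ∧ |u.1| < |u.2| ∧
      wordAct (σ :: w) (0, 1) = tB σ.1 (tA a u)
  | [], σ, _ => by
    refine ⟨σ.sgn, (0, 1), ?_, ?_, by simp, ?_⟩
    · unfold Letter.sgn; split_ifs <;> norm_num
    · unfold Letter.sgn; cases σ.2 <;> simp
    · simp [wordAct, Letter.act]
  | τ :: w, σ, h => by
    obtain ⟨hτσ, hτw⟩ := isReduced_cons_cons.1 h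
    obtain ⟨a, u, ha, hsgn, hu, hEq⟩ := wordAct_invariant w τ hτw
    have hstep : wordAct (σ :: τ :: w) (0, 1) =
        tB σ.1 (tA σ.sgn (tB ((τ.1 : ℤ) - σ.1) (tA a u))) := by
      show σ.act (wordAct (τ :: w) (0, 1)) = _
      rw [hEq, Letter.act, tB_tB]
      congr 2; ring_nf
    by_cases hk : τ.1 = σ.1
    · -- same generator: the signs agree (the word is reduced), the `A`-exponents add up
      have hsame : τ.2 = σ.2 := by
        by_contra hne
        apply hτσ
        refine Prod.ext (by simpa using hk) ?_
        simp only [Letter.bar_snd]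
        cases hτ : τ.2 <;> cases hσ : σ.2 <;> simp_all
      refine ⟨σ.sgn + a, u, ?_, ?_, hu, ?_⟩
      · unfold Letter.sgn
        cases hσ : σ.2
        · have : ¬ 0 < a := fun h0 => by rw [hsgn.1 h0] at hsame; simp [hσ] at hsame
          simp; omega
        · have : 0 < a := hsgn.2 (by rw [hsame, hσ])
          simp; omega
      · unfold Letter.sgn
        cases hσ : σ.2
        · have : ¬ 0 < a := fun h0 => by rw [hsgn.1 h0] at hsame; simp [hσ] at hsame
          simp; omega
        · have : 0 < a := hsgn.2 (by rw [hsame, hσ])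
          simp; omega
      · rw [hstep, hk, sub_self, tB_zero, tA_tA]
    · -- a new generator: pong then ping
      have hk' : (τ.1 : ℤ) - σ.1 ≠ 0 := by
        intro h0
        apply hk
        exact Fin.ext (by exact_mod_cast (sub_eq_zero.1 h0))
      refine ⟨σ.sgn, tB ((τ.1 : ℤ) - σ.1) (tA a u), ?_, ?_, ping hk' (pong ha hu), hstep⟩
      · unfold Letter.sgn; split_ifs <;> norm_num
      · unfold Letter.sgn; cases σ.2 <;> simp

/-- **A nonempty reduced word moves `(0, 1)`** (Sanov 1947: `A` and `B` generate a free group,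
and the conjugates `BᵏAB⁻ᵏ` are free). [folklore] -/
theorem wordAct_ne {w : List Letter} (hw : IsReduced w) (hne : w ≠ []) :
    wordAct w (0, 1) ≠ (0, 1) := by
  obtain ⟨σ, w, rfl⟩ := List.exists_cons_of_ne_nil hne
  obtain ⟨a, u, ha, -, hu, hEq⟩ := wordAct_invariant w σ hw
  rw [hEq]
  intro h
  have h2 : tA a u = (0, 1) := by
    have := congrArg (tB (-(σ.1 : ℤ))) h
    rwa [tB_tB, neg_add_cancel, tB_zero, tB_base] at this
  have h3 := pong ha hu
  rw [h2] at h3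
  simp at h3

/-- The matrix of a letter acts on column vectors as `Letter.act`. [folklore] -/
theorem Letter.mat_mulVec (σ : Letter) (v : ℤ × ℤ) :
    σ.mat.mulVec ![v.1, v.2] = ![(σ.act v).1, (σ.act v).2] := by
  ext i
  fin_cases i <;>
    simp [Letter.mat, Letter.act, tA, tB, Matrix.mulVec, dotProduct, Fin.sum_univ_two] <;> ring

/-- The matrix of a word acts on column vectors as `wordAct`. [folklore] -/
theorem wordMat_mulVec (w : List Letter) (v : ℤ × ℤ) :
    (wordMat w).mulVec ![v.1, v.2] = ![(wordAct w v).1, (wordAct w v).2] := by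
  induction w with
  | nil => simp [wordMat, wordAct]
  | cons σ w ih =>
    simp only [wordMat, wordAct]
    rw [← Matrix.mulVec_mulVec, ih, Letter.mat_mulVec]

/-- **A nonempty reduced word is not the identity matrix.** [cite: Margulis1982, main construction] -/
theorem wordMat_ne_one {w : List Letter} (hw : IsReduced w) (hne : w ≠ []) : wordMat w ≠ 1 := by
  intro h
  apply wordAct_ne hw hne
  have h1 := wordMat_mulVec w (0, 1)
  rw [h, Matrix.one_mulVec] at h1
  have h2 := congrFun h1 0
  have h3 := congrFun h1 1
  simp at h2 h3
  ext <;> simp [← h2, ← h3]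

/-- Entries of a letter matrix are at most `400` in absolute value. [folklore] -/
theorem Letter.abs_mat_le (σ : Letter) (i j : Fin 2) : |σ.mat i j| ≤ 400 := by
  have hk : (σ.1 : ℤ) ≤ 7 := by have := σ.1.isLt; omega
  have hk0 : (0 : ℤ) ≤ σ.1 := by positivity
  have hs : σ.sgn = 1 ∨ σ.sgn = -1 := by unfold Letter.sgn; split_ifs <;> simp
  rw [abs_le]
  constructor <;> rcases hs with hs | hs <;> fin_cases i <;> fin_cases j <;>
    simp [Letter.mat, hs] <;> nlinarith

/-- Product bound for `2 × 2` integer matrices. [folklore] -/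
theorem abs_mul_le {M S : Matrix (Fin 2) (Fin 2) ℤ} {C D : ℤ} (hM : ∀ i j, |M i j| ≤ C)
    (hS : ∀ i j, |S i j| ≤ D) (i j : Fin 2) : |(M * S) i j| ≤ 2 * C * D := by
  rw [Matrix.mul_apply, Fin.sum_univ_two]
  have hC : 0 ≤ C := (abs_nonneg _).trans (hM 0 0)
  have h1 : |M i 0 * S 0 j| ≤ C * D := by
    rw [abs_mul]; exact mul_le_mul (hM i 0) (hS 0 j) (abs_nonneg _) hC
  have h2 : |M i 1 * S 1 j| ≤ C * D := by
    rw [abs_mul]; exact mul_le_mul (hM i 1) (hS 1 j) (abs_nonneg _) hC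
  calc |M i 0 * S 0 j + M i 1 * S 1 j| ≤ |M i 0 * S 0 j| + |M i 1 * S 1 j| := abs_add_le _ _
    _ ≤ 2 * C * D := by linarith

/-- **Entries of a word of length `L` are at most `800^L`.** [cite: Margulis1982, main construction] -/
theorem abs_wordMat_le (w : List Letter) (i j : Fin 2) : |wordMat w i j| ≤ 800 ^ w.length := by
  induction w generalizing i j with
  | nil =>
    simp only [wordMat, List.length_nil, pow_zero]
    fin_cases i <;> fin_cases j <;> simp
  | cons σ w ih =>
    simp only [wordMat, List.length_cons, pow_succ]
    exact (abs_mul_le (fun i j => σ.abs_mat_le i j) (fun i j => ih i j) i j).trans (by ring_nf; rfl)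

/-! ### Reduction modulo `N`: no short relations in `SL₂(ℤ/N)` -/

/-- The generator `s_σ ∈ SL₂(ℤ/N)`: the letter matrix reduced mod `N`. [cite: Margulis1982, main construction] -/
def gen (N : ℕ) (σ : Letter) : Matrix.SpecialLinearGroup (Fin 2) (ZMod N) :=
  ⟨σ.mat.map (Int.castRingHom (ZMod N)), by
    rw [show σ.mat.map (Int.castRingHom (ZMod N)) = (Int.castRingHom (ZMod N)).mapMatrix σ.mat
      from rfl, ← RingHom.map_det, σ.det_mat, map_one]⟩

/-- The value of a word in `SL₂(ℤ/N)` (head = leftmost factor). [folklore] -/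
def wordVal (N : ℕ) (w : List Letter) : Matrix.SpecialLinearGroup (Fin 2) (ZMod N) :=
  (w.map (gen N)).prod

/-- The value of a word is the reduction of its integer matrix. [folklore] -/
theorem coe_wordVal (N : ℕ) (w : List Letter) :
    ((wordVal N w : Matrix.SpecialLinearGroup (Fin 2) (ZMod N)) : Matrix (Fin 2) (Fin 2) (ZMod N)) =
      (wordMat w).map (Int.castRingHom (ZMod N)) := by
  induction w with
  | nil => simp [wordVal, wordMat]
  | cons σ w ih =>
    simp only [wordVal, List.map_cons, List.prod_cons, Matrix.SpecialLinearGroup.coe_mul] at ih ⊢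
    rw [ih, wordMat, Matrix.map_mul]
    rfl

/-- The generator of the formal inverse is the inverse. [folklore] -/
theorem gen_bar (N : ℕ) (σ : Letter) : gen N σ.bar = (gen N σ)⁻¹ := by
  symm
  rw [inv_eq_iff_mul_eq_one]
  apply Subtype.ext
  rw [Matrix.SpecialLinearGroup.coe_mul, Matrix.SpecialLinearGroup.coe_one]
  show σ.mat.map _ * σ.bar.mat.map _ = 1
  rw [← Matrix.map_mul, σ.mat_mul_mat_bar]
  simp

/-- **No short relations.** If `2 · 800^L < N`, no nonempty reduced word of length `≤ L` is
the identity of `SL₂(ℤ/N)`: its integer matrix has entries `< N/2` in absolute value and is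
not the identity. [cite: Margulis1982, girth bound] -/
theorem wordVal_ne_one {N L : ℕ} (hN : 2 * 800 ^ L < N) {w : List Letter} (hw : IsReduced w)
    (hne : w ≠ []) (hL : w.length ≤ L) : wordVal N w ≠ 1 := by
  intro h
  apply wordMat_ne_one hw hne
  have hc := congrArg (fun g : Matrix.SpecialLinearGroup (Fin 2) (ZMod N) =>
    (g : Matrix (Fin 2) (Fin 2) (ZMod N))) h
  simp only [coe_wordVal, Matrix.SpecialLinearGroup.coe_one] at hc
  have hNpos : (0 : ℤ) < N := by exact_mod_cast (show 0 < N by omega)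
  have hpow : (800 : ℤ) ^ w.length ≤ 800 ^ L := pow_le_pow_right₀ (by norm_num) hL
  have hNL : 2 * (800 : ℤ) ^ L < N := by exact_mod_cast hN
  ext i j
  have hij := congrFun (congrFun hc i) j
  simp only [Matrix.map_apply, Int.coe_castRingHom] at hij
  -- `wordMat w i j ≡ δ i j (mod N)` and both are small
  have hsmall := abs_wordMat_le w i j
  have key : ((wordMat w i j - (1 : Matrix (Fin 2) (Fin 2) ℤ) i j : ℤ) : ZMod N) = 0 := by
    push_cast
    rw [hij, sub_eq_zero]
    fin_cases i <;> fin_cases j <;> simp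
  rw [ZMod.intCast_zmod_eq_zero_iff_dvd] at key
  have habs : |wordMat w i j - (1 : Matrix (Fin 2) (Fin 2) ℤ) i j| < N := by
    have h1 : |(1 : Matrix (Fin 2) (Fin 2) ℤ) i j| ≤ 1 := by
      fin_cases i <;> fin_cases j <;> simp
    have hone : (1 : ℤ) ≤ 800 ^ L := one_le_pow₀ (by norm_num)
    calc |wordMat w i j - (1 : Matrix (Fin 2) (Fin 2) ℤ) i j|
        ≤ |wordMat w i j| + |(1 : Matrix (Fin 2) (Fin 2) ℤ) i j| := abs_sub _ _
      _ < N := by linarith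
  exact sub_eq_zero.1 (Int.eq_zero_of_abs_lt_dvd key habs)

end FreeCayley

end Summit.PneNP.PneNP.Theorems
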